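import Summits.AtomisticToContinuum.Crystallization.Theses.HullMinimality
import Summits.AtomisticToContinuum.Crystallization.Theorems.NashClassCertificatesNashHullBridge
import Summits.AtomisticToContinuum.Crystallization.Theorems.HullMinimalityLayeredWindowsReductions
import Summits.AtomisticToContinuum.Crystallization.Theorems.HullMinimalityLayeredWindowsFrequently
import Summits.AtomisticToContinuum.Crystallization.Theorems.HullMinimalityLayeredWindowsNecessity

/-!
# Crux `HullMinimality.LayeredWindows` (stmt-AtomisticToContinuum-11778) — line `registered`, skeleton v5
# (lead c4: the positional stub weakened to its FREQUENTLY-in-`N` form, which is proved NECESSARY; S2 = item 16827)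

Composition idea of the line (unchanged since v1 / lead c2): along a Lennard-Jones ground-state sequence, CLEAN
CENTRES — a particle whose whole `R'`-ball is crux-good and `η`-layered-near — give layered windows at every scale
with ONE in-layer spacing (`HullBridgeExact.stub_windowsOfGluing` + the proved gluing lemma
`PrestressSplitKorn.stub_layeredGluing`); clean centres come from ONE all-two-shell-good ball by the LOCALISED
clean-centre argument (stubs S3–S7 of v2–v4, all LANDED by lead c3, glue `LayeredWindowsLocal.cleanCentres_of` p151257).

v5 (lead c4) changes only the positional stub, and lands everything around it:
* S1 `stub_twoShellGoodWindowsFreq` — along every ground-state sequence and for every radius `ρ`, FREQUENTLY in `N`,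
  some particle has an all-two-shell-good `ρ`-ball.  This is WEAKER than v4's S1 (eventually in `N`) and still
  sufficient (`LayeredWindowsLocal.layeredWindows_of_goodWindows_freq`, LANDED p154375: pointwise clean centre
  `cleanCentre_of_goodBall` + accumulation point from frequently-existing windows), and it is NECESSARY:
  `LayeredWindowsLocal.layeredWindows_necessity : LayeredWindows → S1` (LANDED, `Theorems/HullMinimalityLayeredWindowsNecessity.lean`
  + `…TwoShellSites.lean` p155106: a particle `2` inside an `(R, 1/200)`-window of a `1/3`-separated configuration is
  `IsTwoShellGood (1/20) (47/50) 1` — the eighteen two-shell sites of a box template, close-packing frame, `37a/1000`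
  vertical relaxation `+ 2/200 < a/20`).  Hence MODULO S2 THE CRUX IS EQUIVALENT TO S1 (`crux_iff_S1_of_S2` below), and
  UNCONDITIONALLY the crux is equivalent to "clean centres frequently" (`crux_iff_cleanCentresFreq`,
  = `LayeredWindowsLocal.layeredWindows_iff_cleanCentresFreq`).
* S2 `stub_nashNearField` = item stmt-AtomisticToContinuum-16827 `NashClassCertificates.NashNearField` BY NAME (own crux chain
  `Cruxes/NashNearField/Lines/birth.lean`; ⇐ 13958 by `nashNearField_of_nearFieldConvexity`, LANDED p154158).
* By-name edges LANDED p154158 (`Theorems/HullMinimalityLayeredWindowsReductions.lean`): 13956 → 16826 → (v4-S1 ⇒) S1,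
  13958 → 16827, 13956 → 13958 → crux.

S1 is the qualitative positional core of 3-D Lennard-Jones crystallization ("infinitely often a ground state contains an
arbitrarily large ball of fcc/hcp-coordinated particles"); no unconditional route is known (BlancLewin2015 §3: nothing
beyond `d = 2`).  It is now pinned as a CONSEQUENCE of the crux, not an artefact of the line.
-/

noncomputable section

open scoped BigOperators Classical InnerProductSpace
open Filter Topology

namespace Summit.AtomisticToContinuum.Crystallization.Cruxes.LayeredWindows.Registered

open Summit.AtomisticToContinuum.Crystallization.Theses
open Summit.AtomisticToContinuum.Crystallization.Theorems
open Summit.AtomisticToContinuum.Crystallization.Theorems.PrestressSplitKorn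
open Summit.AtomisticToContinuum.Crystallization.Theorems.DefectFreeCrystallizes.Negative.PredicateAPI (Good)
open Literature.MathematicalPhysics.StatisticalMechanics Literature.Geometry.DiscreteGeometry

local notation "E3" => EuclideanSpace ℝ (Fin 3)

/-! ## The stubs -/

/-- **Stub S1 `stub_twoShellGoodWindowsFreq` (the positional leaf, frequently form; crux-sized physics, held by the
lead; NECESSARY for the crux by `LayeredWindowsLocal.layeredWindows_necessity`).** Along every Lennard-Jones
ground-state sequence and for every radius `ρ`, frequently in `N`, some particle has every particle within `ρ` of it
two-shell good (`IsTwoShellGood (1/20) (47/50) 1`). -/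
theorem stub_twoShellGoodWindowsFreq :
    ∀ x : (N : ℕ) → (Fin N → E3), (∀ N, IsGroundState lennardJones (x N)) → ∀ ρ : ℝ, ∃ᶠ N : ℕ in atTop, ∃ i : Fin N, ∀ j : Fin N, dist (x N j) (x N i) ≤ ρ → IsTwoShellGood (1 / 20) (47 / 50) 1 (x N) j := by
  sorry

/-- **Stub S2 `stub_nashNearField` = item stmt-AtomisticToContinuum-16827 BY NAME** (near field on the Nash class:
`c·#{non-η-layered in Ω} − C·#∂₄Ω ≤ Σ_Ω (½𝓔ⁱ − e*)` for sets `Ω` of two-shell-good sites of `1/3`-separated Nash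
configurations). -/
theorem stub_nashNearField : Summit.AtomisticToContinuum.Crystallization.Theses.NashClassCertificates.NashNearField := by
  sorry

/-! ## What is landed around the stubs (no sorry below this line except through S1/S2) -/

/-- v4's S1 (EVENTUALLY in `N`) implies v5's S1 (frequently): the reshaping only weakened the stub. -/
theorem twoShellGoodWindowsFreq_of_eventually
    (h : ∀ x : (N : ℕ) → (Fin N → E3), (∀ N, IsGroundState lennardJones (x N)) → ∀ ρ : ℝ,
      ∀ᶠ N : ℕ in atTop, ∃ i : Fin N, ∀ j : Fin N, dist (x N j) (x N i) ≤ ρ → IsTwoShellGood (1 / 20) (47 / 50) 1 (x N) j) :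
    ∀ x : (N : ℕ) → (Fin N → E3), (∀ N, IsGroundState lennardJones (x N)) → ∀ ρ : ℝ,
      ∃ᶠ N : ℕ in atTop, ∃ i : Fin N, ∀ j : Fin N, dist (x N j) (x N i) ≤ ρ → IsTwoShellGood (1 / 20) (47 / 50) 1 (x N) j :=
  fun x hx ρ => (h x hx ρ).frequently

/-- S1 from item 16826 (`NashTwoShellGap`), hence from 13956 (`CoerciveTwoShellGap`) — LANDED reductions. -/
theorem stub_twoShellGoodWindowsFreq_of_nashTwoShellGap (hG : NashClassCertificates.NashTwoShellGap) :
    ∀ x : (N : ℕ) → (Fin N → E3), (∀ N, IsGroundState lennardJones (x N)) → ∀ ρ : ℝ,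
      ∃ᶠ N : ℕ in atTop, ∃ i : Fin N, ∀ j : Fin N, dist (x N j) (x N i) ≤ ρ → IsTwoShellGood (1 / 20) (47 / 50) 1 (x N) j :=
  twoShellGoodWindowsFreq_of_eventually (LayeredWindowsLocal.twoShellGoodWindows_of_nashTwoShellGap hG)

/-- **NECESSITY of S1** (LANDED `LayeredWindowsLocal.layeredWindows_necessity`): the crux implies S1. -/
theorem stub_twoShellGoodWindowsFreq_of_crux (hLW : Summit.AtomisticToContinuum.Crystallization.Theses.HullMinimality.LayeredWindows) :
    ∀ x : (N : ℕ) → (Fin N → E3), (∀ N, IsGroundState lennardJones (x N)) → ∀ ρ : ℝ,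
      ∃ᶠ N : ℕ in atTop, ∃ i : Fin N, ∀ j : Fin N, dist (x N j) (x N i) ≤ ρ → IsTwoShellGood (1 / 20) (47 / 50) 1 (x N) j :=
  LayeredWindowsLocal.layeredWindows_necessity hLW

/-- **Modulo S2 the crux is EQUIVALENT to S1** (sufficiency `layeredWindows_of_goodWindows_freq` p154375, necessity
`layeredWindows_necessity`). -/
theorem crux_iff_S1_of_S2 (hNF : Summit.AtomisticToContinuum.Crystallization.Theses.NashClassCertificates.NashNearField) :
    Summit.AtomisticToContinuum.Crystallization.Theses.HullMinimality.LayeredWindows ↔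
      ∀ x : (N : ℕ) → (Fin N → E3), (∀ N, IsGroundState lennardJones (x N)) → ∀ ρ : ℝ,
        ∃ᶠ N : ℕ in atTop, ∃ i : Fin N, ∀ j : Fin N, dist (x N j) (x N i) ≤ ρ → IsTwoShellGood (1 / 20) (47 / 50) 1 (x N) j :=
  ⟨LayeredWindowsLocal.layeredWindows_necessity, fun h => LayeredWindowsLocal.layeredWindows_of_goodWindows_freq h hNF⟩

/-- **Unconditionally, the crux is EQUIVALENT to "clean centres frequently"** (LANDED
`LayeredWindowsLocal.layeredWindows_iff_cleanCentresFreq`): for every ground-state sequence, every `η > 0` and `R'`,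
frequently in `N`, a particle whose `R'`-ball is all-`Good` and all-`LayeredNear η`.  S2's only role in the line is to upgrade
S1 (two-shell good balls) to this (energy kills the residual strain inside all-good balls: `cleanCentre_of_goodBall`). -/
theorem crux_iff_cleanCentresFreq :
    Summit.AtomisticToContinuum.Crystallization.Theses.HullMinimality.LayeredWindows ↔
      ∀ x : (N : ℕ) → (Fin N → E3), (∀ N, IsGroundState lennardJones (x N)) →
        ∀ η : ℝ, 0 < η → ∀ R' : ℝ, ∃ᶠ N : ℕ in atTop, ∃ i : Fin N, ∀ j : Fin N,
          dist (x N j) (x N i) ≤ R' → Good (x N) j ∧ LayeredNear η (x N) j :=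
  LayeredWindowsLocal.layeredWindows_iff_cleanCentresFreq

/-! ## Composition (v5) -/

/-- **The line concludes the crux by name**: `LayeredWindows` from S1 (all-two-shell-good balls of every radius,
frequently, along every ground-state sequence) and S2 (`NashNearField`, item 16827) by the LANDED bridge
`LayeredWindowsLocal.layeredWindows_of_goodWindows_freq` (pointwise clean centre → `windowsOfGluing_freq` with the gluing
lemma `PrestressSplitKorn.stub_layeredGluing`). -/
theorem LayeredWindows_of : Summit.AtomisticToContinuum.Crystallization.Theses.HullMinimality.LayeredWindows :=
  LayeredWindowsLocal.layeredWindows_of_goodWindows_freq stub_twoShellGoodWindowsFreq stub_nashNearField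

end Summit.AtomisticToContinuum.Crystallization.Cruxes.LayeredWindows.Registered

end
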